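import Summits.KontsevichZagierPeriods.KontsevichZagierPeriods.Theorems.HurwitzMicroSectorsNormalFormPrincipleWNPowerSubstitution
import Summits.KontsevichZagierPeriods.KontsevichZagierPeriods.Theorems.HurwitzMicroSectorsNormalFormPrincipleWNPerm
import Summits.KontsevichZagierPeriods.KontsevichZagierPeriods.Theorems.HurwitzMicroSectorsNormalFormPrincipleWNMerge
import Summits.KontsevichZagierPeriods.KontsevichZagierPeriods.Theorems.HurwitzMicroSectorsNormalFormPrincipleWNReband
import Summits.KontsevichZagierPeriods.KontsevichZagierPeriods.Theorems.HurwitzMicroSectorsNormalFormPrincipleWNStokes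
import Summits.KontsevichZagierPeriods.KontsevichZagierPeriods.Theorems.HurwitzMicroSectorsNormalFormPrincipleWNExistsReps
import Summits.KontsevichZagierPeriods.KontsevichZagierPeriods.Theorems.HurwitzMicroSectorsNormalFormPrincipleLevelKTriangleSubDimOne
import Summits.KontsevichZagierPeriods.KontsevichZagierPeriods.Theorems.HurwitzMicroSectorsNormalFormPrincipleLevelKExistsReps
import Summits.KontsevichZagierPeriods.KontsevichZagierPeriods.Theorems.HurwitzMicroSectorsNormalFormPrincipleLevelKDimOneIsRational
import Summits.KontsevichZagierPeriods.KontsevichZagierPeriods.Theorems.HurwitzMicroSectorsNormalFormPrincipleDimOneAssembly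

/-!
# `NormalFormPrinciple` (stmt-KontsevichZagierPeriods-3869), line `SketchIdeator1` — leaf `stub_boxRigidity`:
# ALL WEIGHTS, ALL LEVELS, TOTALLY OFF RESONANCE: Conjecture 1 (kernel form), unconditionally

Boxes `[(0,1)^w, c (Π_l x_l^{e_l})/(1 − Π_l x_l^{k_l})]`, `w ≥ 2`, `c ∈ ℚ`, `k_l ≥ 1`, whose resonance
parameters `θ_l = (e_l+1)/k_l` are PAIRWISE DISTINCT (values: `ℚ`-combinations of digamma values at
rationals, i.e. elements of the Baker module `ℚ̄ + ℚ̄π + Σ ℚ̄ log ℚ̄`). The dimension-generic version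
of `…LevelKLayer` (w = 2) and `…Weight3Layer` (w = 3).

Chain of moves per box: the power substitution `x_l ↦ x_l^{Π_{j≠l} k_j}` (rule 2, `power_substitutionN`)
makes the level uniform, `K = Π k_j`, with pairwise distinct exponents; a coordinate permutation
(rule 2, `permN`, `Tuple.sort`) sorts them strictly decreasingly; the merge `t = Π x_l` (rule 2,
affine in the last coordinate, `mergeN`) gives the band `R_{w−1}(A; D)` over `(0,1)^{w−1}` with
strictly decreasing `A`; then the INDUCTION `band_exists_mem_dimLeOneClosure`: re-band by swapping
the last two coordinates (rule 2 + null sets, `rebandN`), integrate out the last coordinate over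
`[t/Π, 1]` (rule 3, `stokesN`): the base integrand
`(c/(Aₙ+1))((Π yᵢ^{Aᵢ}) t^D − (Π yᵢ^{Aᵢ−Aₙ−1}) t^{D+Aₙ+1})/(1 − t^K)` splits (rule 1) into two bands
`R_{n}` with strictly decreasing exponents, down to the level-`K` triangle of wave 8
(`LevelK.levelK_triangle_sub_dimOne`, `LevelK.levelK_dimOne_isRational`): every such box is congruent
modulo relations to a `ℤ`-combination of RATIONAL representations of dimension one, where seat c4's
kernel theorem (`Dlog.mem_relations_of_eval_eq_zero_of_dim_le_one`, Baker) applies: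
CONJECTURE 1 OF KONTSEVICH–ZAGIER HOLDS, IN KERNEL FORM, ON THE TOTALLY-OFF-RESONANCE BOX LAYER OF
ALL WEIGHTS AND LEVELS, UNCONDITIONALLY (`offresN_mem_relations_of_eval_eq_zero_of_mem_closure`);
e.g. `∫_{(0,1)⁴} x₁x₂²x₃³/(1 − x₀x₁x₂x₃) = Σ_n 1/((n+1)(n+2)(n+3)(n+4)) = 1/18` against `[pt, 1/18]`
(`offresN_equivalent_dimLeOne_of_value_eq`).
References: M. Kontsevich, D. Zagier, *Periods* (2001), §1.2 Conjecture 1; A. Baker, *Transcendental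
Number Theory* (1975), Thm. 2.1 (as landed in the tree). No new definitions.
-/

noncomputable section

open MeasureTheory Set
open Literature.NumberTheory.Transcendental Literature.NumberTheory.Transcendental.KZ
open Literature.ModelTheory.ExponentialFields (IsSemialgebraic)

namespace Summit.KontsevichZagierPeriods.HurwitzMicroSectors.NormalFormPrinciple.PiBox.WeightN

/-! ## The assembly (lead): the induction on the base dimension -/

open Summit.KontsevichZagierPeriods.HurwitzMicroSectors.NormalFormPrinciple.PiBox.Dlog
  (mem_relations_of_eval_eq_zero_of_dim_le_one)
open Summit.KontsevichZagierPeriods.HurwitzMicroSectors.NormalFormPrinciple.PiBox.LevelK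
  (levelK_triangle_sub_dimOne levelK_exists_reps levelK_dimOne_isRational)

/-- **The induction**: for `n ≥ 1` and STRICTLY ADMISSIBLE exponents (`A_last + 1 ≤ A_i` recursively is
guaranteed by strict decrease), the band `R_n(A; D)` with a rational coefficient is congruent modulo
relations to an element of the subgroup generated by the rational representations of dimension
`≤ 1`. [cite: KontsevichZagier2001, §1.2] -/
theorem band_exists_mem_dimLeOneClosure (K : ℕ) (hK : 0 < K) :
    ∀ (n : ℕ) (A : Fin (n + 1) → ℕ) (D : ℕ), StrictAnti A → ∀ (c : ℚ) (R : IntegralRep (n + 2)),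
    R.domain = KZlog.band {y : Fin (n + 1) → ℝ | ∀ i, y i ∈ Set.Ioo (0:ℝ) 1} (fun _ => (0:ℝ))
      (fun y => ∏ i, y i) →
    EqOn R.integrand (fun z => (c : ℝ) * (∏ i : Fin (n + 1), z (Fin.castSucc i) ^ (A i)) *
        z (Fin.last (n + 1)) ^ D / (1 - z (Fin.last (n + 1)) ^ K)) R.domain →
    ∃ x' ∈ AddSubgroup.closure
        {y : FormalRep | ∃ (m : ℕ) (M : IntegralRep m), m ≤ 1 ∧ M.IsRational ∧ y = of M},
      of R - x' ∈ relations := by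
  intro n
  induction n with
  | zero =>
    -- base: `R` is the level-K triangle `[{0<x<1, 0≤t≤x}, c x^{A 0} t^D/(1 − t^K)]` of wave 8
    intro A D _ c R hRd hRi
    have hc : IsAlgebraic ℚ (c : ℝ) := isAlgebraic_algebraMap c
    obtain ⟨-, -, hexN₁⟩ := levelK_exists_reps K hK (c : ℝ) hc
    obtain ⟨N₁, hN₁d, hN₁i⟩ := hexN₁ (A 0 + D + 1) D
    -- identify the domains/integrands with wave 8's spelling
    have hRd' : R.domain = KZlog.band {y : Fin 1 → ℝ | 0 < y 0 ∧ y 0 < 1} (fun _ => (0:ℝ)) (fun y => y 0) := by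
      rw [hRd]
      congr 1
      · ext y; simp [Fin.forall_fin_one]
      · funext y; simp
    have hRi' : EqOn R.integrand (fun z => (c : ℝ) * (z 0 ^ (A 0 + D + 1 - D - 1) * z 1 ^ D) /
        (1 - z 1 ^ K)) R.domain := fun z hz => by
      rw [hRi hz]
      have e1 : A 0 + D + 1 - D - 1 = A 0 := by omega
      beta_reduce
      rw [e1, Fin.prod_univ_succ, Fin.prod_univ_zero, mul_one,
        show (Fin.castSucc (0 : Fin (0 + 1)) : Fin (0 + 1 + 1)) = 0 from rfl,
        show (Fin.last (0 + 1) : Fin (0 + 1 + 1)) = 1 from rfl]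
      ring
    have e := levelK_triangle_sub_dimOne K hK (A 0 + D + 1) D (c : ℝ) hc (by omega) R N₁ hRd' hRi'
      hN₁d (hN₁i ▸ fun _ _ => rfl)
    exact ⟨of N₁, AddSubgroup.subset_closure ⟨1, N₁, le_rfl,
      levelK_dimOne_isRational K hK _ _ c N₁ hN₁d (fun z _ => by rw [hN₁i]), rfl⟩, e⟩
  | succ n ih =>
    intro A D hA c R hRd hRi
    have hc : IsAlgebraic ℚ (c : ℝ) := isAlgebraic_algebraMap c
    -- admissibility of the last exponent
    have hlast : ∀ i : Fin (n + 1), A (Fin.last (n + 1)) + 1 ≤ A (Fin.castSucc i) := fun i =>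
      hA (Fin.castSucc_lt_last i)
    -- the base rep `T` on the `R_{n+1}`-domain and the two new bands
    obtain ⟨-, -, hexRn⟩ := exists_repsN K hK (c : ℝ) hc
    obtain ⟨R', hR'd, hR'i⟩ := hexRn (n + 1) A D
    have e0 := rebandN (n + 1) K hK A D (c : ℝ) hc R R' hRd hRi hR'd (hR'i ▸ fun _ _ => rfl)
    set c' : ℚ := c / ((A (Fin.last (n + 1)) + 1 : ℕ) : ℚ) with hc'def
    have hc' : IsAlgebraic ℚ (c' : ℝ) := isAlgebraic_algebraMap c'
    obtain ⟨-, hexR', -⟩ := exists_repsN K hK (c' : ℝ) hc'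
    obtain ⟨R₁, hR₁d, hR₁i⟩ := hexR' (n + 1) (fun i => A (Fin.castSucc i)) D (Nat.succ_pos n)
    obtain ⟨R₂, hR₂d, hR₂i⟩ := hexR' (n + 1) (fun i => A (Fin.castSucc i) - A (Fin.last (n + 1)) - 1)
      (D + A (Fin.last (n + 1)) + 1) (Nat.succ_pos n)
    -- `T := R₁ − R₂` as a rep (integrand subtraction)
    let T : IntegralRep (n + 2) :=
      ⟨R₁.domain, fun z => (c' : ℝ) *
        ((∏ i : Fin (n + 1), z (Fin.castSucc i) ^ (A (Fin.castSucc i))) * z (Fin.last (n + 1)) ^ D -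
         (∏ i : Fin (n + 1), z (Fin.castSucc i) ^ (A (Fin.castSucc i) - A (Fin.last (n + 1)) - 1)) *
           z (Fin.last (n + 1)) ^ (D + A (Fin.last (n + 1)) + 1)) / (1 - z (Fin.last (n + 1)) ^ K),
        R₁.isSemialgebraic_domain,
        (IsSemialgebraicFunOn.sub_holds R₁.isSemialgebraicFunOn_integrand
          (hR₂d.trans hR₁d.symm ▸ R₂.isSemialgebraicFunOn_integrand)).congr fun z _ => by
            rw [hR₁i, hR₂i]; simp only [Pi.sub_apply]; ring,
        (R₁.integrableOn.sub ((hR₂d.trans hR₁d.symm) ▸ R₂.integrableOn)).congr_fun (fun z _ => by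
            rw [hR₁i, hR₂i]; simp only [Pi.sub_apply]; ring) (IntegralRep.measurableSet_domain_holds R₁)⟩
    have hTd : T.domain = _ := hR₁d
    have hc'' : (c' : ℝ) = (c : ℝ) / ((A (Fin.last (n + 1)) + 1 : ℕ) : ℝ) := by
      rw [hc'def]; push_cast; ring
    have e1' := stokesN (n + 1) K hK A D hlast (c : ℝ) hc R' T hR'd (hR'i ▸ fun _ _ => rfl) hTd
      (fun z _ => by
        show T.integrand z = _
        simp only [T, hc''])
    have e1 : of R - of T ∈ relations := by
      have ee : of R - of T = (of R - of R') + (of R' - of T) := by abel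
      rw [ee]; exact relations.add_mem e0 e1'
    -- `R₁ = T + R₂`
    have e2 : of R₁ - of T - of R₂ ∈ relations := by
      refine integrandAddRel_subset_relations ⟨n + 2, R₁, T, R₂, rfl, hR₂d.trans hR₁d.symm,
        fun z _ => ?_, rfl⟩
      show R₁.integrand z = T.integrand z + R₂.integrand z
      rw [hR₁i, hR₂i]
      simp only [T]
      ring
    -- induction hypotheses for `R₁` and `R₂`
    have hA₁ : StrictAnti (fun i : Fin (n + 1) => A (Fin.castSucc i)) := fun i j hij =>
      hA (Fin.castSucc_lt_castSucc_iff.2 hij)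
    have hA₂ : StrictAnti (fun i : Fin (n + 1) => A (Fin.castSucc i) - A (Fin.last (n + 1)) - 1) := by
      intro i j hij
      have h1 := hA (Fin.castSucc_lt_castSucc_iff.2 hij)
      have h2 := hlast j
      simp only
      omega
    obtain ⟨x₁, hx₁, f₁⟩ := ih (fun i : Fin (n + 1) => A (Fin.castSucc i)) D hA₁ c' R₁ hR₁d
      (fun z _ => by rw [hR₁i])
    obtain ⟨x₂, hx₂, f₂⟩ := ih (fun i : Fin (n + 1) => A (Fin.castSucc i) - A (Fin.last (n + 1)) - 1)
      (D + A (Fin.last (n + 1)) + 1) hA₂ c' R₂ hR₂d (fun z _ => by rw [hR₂i])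
    refine ⟨x₁ - x₂, AddSubgroup.sub_mem _ hx₁ hx₂, ?_⟩
    have e : of R - (x₁ - x₂) = (of R - of T) - (of R₁ - of T - of R₂) + (of R₁ - x₁) - (of R₂ - x₂) := by
      abel
    rw [e]
    exact relations.sub_mem (relations.add_mem (relations.sub_mem e1 e2) f₁) f₂

/-- **Sorting the exponents** (rule 2, a coordinate permutation): pairwise distinct exponents can be
made strictly decreasing. [folklore] -/
theorem exists_perm_strictAnti {w : ℕ} (e : Fin w → ℕ) (he : Function.Injective e) :
    ∃ σ : Equiv.Perm (Fin w), StrictAnti (e ∘ σ) := by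
  refine ⟨Tuple.sort (OrderDual.toDual ∘ e), ?_⟩
  have hmono : Monotone ((OrderDual.toDual ∘ e) ∘ Tuple.sort (OrderDual.toDual ∘ e)) :=
    Tuple.monotone_sort _
  have hinj : Function.Injective ((OrderDual.toDual ∘ e) ∘ Tuple.sort (OrderDual.toDual ∘ e)) :=
    (OrderDual.toDual.injective.comp he).comp (Equiv.injective _)
  have hsm := hmono.strictMono_of_injective hinj
  intro i j hij
  exact hsm hij

/-- **From the box to the band** (`w = n + 2 ≥ 2`): sort, merge, then the induction.
[cite: KontsevichZagier2001, §1.2] -/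
theorem box_exists_mem_dimLeOneClosure (K : ℕ) (hK : 0 < K) (n : ℕ) (e : Fin (n + 2) → ℕ)
    (he : Function.Injective e) (c : ℚ) (N : IntegralRep (n + 2))
    (hNd : N.domain = {x | ∀ i, x i ∈ Set.Ioo (0:ℝ) 1})
    (hNi : EqOn N.integrand (fun x => (c : ℝ) * (∏ l, x l ^ (e l)) / (1 - ∏ l, x l ^ K)) N.domain) :
    ∃ x' ∈ AddSubgroup.closure
        {y : FormalRep | ∃ (m : ℕ) (M : IntegralRep m), m ≤ 1 ∧ M.IsRational ∧ y = of M},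
      of N - x' ∈ relations := by
  have hc : IsAlgebraic ℚ (c : ℝ) := isAlgebraic_algebraMap c
  obtain ⟨σ, hσ⟩ := exists_perm_strictAnti e he
  obtain ⟨hexN, hexR, -⟩ := exists_repsN K hK (c : ℝ) hc
  obtain ⟨N', hN'd, hN'i⟩ := hexN (n + 2) (e ∘ σ) (by omega)
  have e0 := permN (n + 2) K hK e σ (c : ℝ) hc N N' hNd hNi hN'd (hN'i ▸ fun _ _ => rfl)
  -- merge
  set A : Fin (n + 1) → ℕ := fun i => (e ∘ σ) (Fin.castSucc i) - (e ∘ σ) (Fin.last (n + 1)) - 1 with hAdef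
  have hlast : ∀ i : Fin (n + 1), (e ∘ σ) (Fin.last (n + 1)) < (e ∘ σ) (Fin.castSucc i) := fun i =>
    hσ (Fin.castSucc_lt_last i)
  obtain ⟨R, hRd, hRi⟩ := hexR (n + 1) A ((e ∘ σ) (Fin.last (n + 1))) (Nat.succ_pos n)
  have e1 := mergeN (n + 1) K hK (e ∘ σ) hlast (c : ℝ) hc N' R hN'd (hN'i ▸ fun _ _ => rfl) hRd
    (fun z _ => by rw [hRi])
  have hA : StrictAnti A := by
    intro i j hij
    have h1 := hσ (Fin.castSucc_lt_castSucc_iff.2 hij)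
    have h2 := hlast j
    simp only [hAdef, Function.comp] at h1 h2 ⊢
    omega
  obtain ⟨x', hx', e2⟩ := band_exists_mem_dimLeOneClosure K hK n A _ hA c R hRd (fun z _ => by rw [hRi])
  refine ⟨x', hx', ?_⟩
  have ee : of N - x' = (of N - of N') + (of N' - of R) + (of R - x') := by abel
  rw [ee]
  exact relations.add_mem (relations.add_mem e0 e1) e2

/-- **General levels**: with `kᵢ ≥ 1` and `(eᵢ+1) kⱼ ≠ (eⱼ+1) kᵢ` for `i ≠ j` (pairwise distinct
resonance parameters `θᵢ = (eᵢ+1)/kᵢ`), the power substitution `xᵢ ↦ xᵢ^{Π_{j≠i} kⱼ}` (rule 2) makes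
the level uniform and the exponents pairwise distinct. [cite: KontsevichZagier2001, §1.2 rule (2)] -/
theorem offresN_exists_mem_dimLeOneClosure (n : ℕ) (k e : Fin (n + 2) → ℕ) (hk : ∀ i, 0 < k i)
    (hres : ∀ i j, i ≠ j → (e i + 1) * k j ≠ (e j + 1) * k i) (c : ℚ) (N : IntegralRep (n + 2))
    (hNd : N.domain = {x | ∀ i, x i ∈ Set.Ioo (0:ℝ) 1})
    (hNi : EqOn N.integrand (fun x => (c : ℝ) * (∏ l, x l ^ (e l)) / (1 - ∏ l, x l ^ (k l))) N.domain) :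
    ∃ x' ∈ AddSubgroup.closure
        {y : FormalRep | ∃ (m : ℕ) (M : IntegralRep m), m ≤ 1 ∧ M.IsRational ∧ y = of M},
      of N - x' ∈ relations := by
  classical
  have hc : IsAlgebraic ℚ (c : ℝ) := isAlgebraic_algebraMap c
  -- the uniform level and the cofactors
  set K : ℕ := ∏ j, k j with hKdef
  set m : Fin (n + 2) → ℕ := fun i => ∏ j ∈ Finset.univ.erase i, k j with hmdef
  have hmK : ∀ i, k i * m i = K := fun i => by
    simp only [hmdef, hKdef]
    exact Finset.mul_prod_erase _ _ (Finset.mem_univ i)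
  have hm : ∀ i, 0 < m i := fun i => Finset.prod_pos fun j _ => hk j
  have hK : 0 < K := Finset.prod_pos fun j _ => hk j
  -- the substituted box
  set c' : ℚ := c * ((∏ i, m i : ℕ) : ℚ) with hc'def
  have hc' : IsAlgebraic ℚ (c' : ℝ) := isAlgebraic_algebraMap c'
  obtain ⟨hexN, -, -⟩ := exists_repsN K hK (c' : ℝ) hc'
  obtain ⟨N', hN'd, hN'i⟩ := hexN (n + 2) (fun i => (e i + 1) * m i - 1) (by omega)
  have e0 := power_substitutionN (n + 2) m k e hm hk (c : ℝ) hc N N' hNd hNi hN'd (fun x _ => by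
    rw [hN'i, hc'def]
    have hprod : (∏ i, x i ^ (k i * m i)) = ∏ i, x i ^ K := Finset.prod_congr rfl fun i _ => by rw [hmK]
    beta_reduce
    rw [hprod]
    push_cast
    ring)
  -- the new exponents are pairwise distinct
  have hinj : Function.Injective (fun i => (e i + 1) * m i - 1) := by
    intro i j hij
    by_contra hne
    apply hres i j hne
    have hi : 0 < (e i + 1) * m i := Nat.mul_pos (Nat.succ_pos _) (hm i)
    have hj : 0 < (e j + 1) * m j := Nat.mul_pos (Nat.succ_pos _) (hm j)
    have h1 : (e i + 1) * m i = (e j + 1) * m j := by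
      simp only at hij
      omega
    -- multiply by `k i * k j` and cancel `K`
    have h2 : (e i + 1) * k j * K = (e j + 1) * k i * K := by
      calc (e i + 1) * k j * K = (e i + 1) * k j * (k i * m i) := by rw [hmK]
        _ = ((e i + 1) * m i) * (k i * k j) := by ring
        _ = ((e j + 1) * m j) * (k i * k j) := by rw [h1]
        _ = (e j + 1) * k i * (k j * m j) := by ring
        _ = (e j + 1) * k i * K := by rw [hmK]
    exact Nat.eq_of_mul_eq_mul_right hK h2
  obtain ⟨x', hx', e1⟩ := box_exists_mem_dimLeOneClosure K hK n _ hinj c' N' hN'd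
    (fun x _ => by rw [hN'i])
  refine ⟨x', hx', ?_⟩
  have ee : of N - x' = (of N - of N') + (of N' - x') := by abel
  rw [ee]
  exact relations.add_mem e0 e1

/-- Every element of the subgroup generated by the totally-off-resonance boxes (all weights `≥ 2`, all
levels) and the rational representations of dimension `≤ 1` is congruent modulo relations to an element
of the subgroup generated by the latter alone. [cite: KontsevichZagier2001, §1.2] -/
theorem exists_mem_dimLeOneClosure_of_mem_offresNClosure {x : FormalRep}
    (hx : x ∈ AddSubgroup.closure
      ({y : FormalRep | ∃ (n : ℕ) (k e : Fin (n + 2) → ℕ) (c : ℚ) (N : IntegralRep (n + 2)),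
          (∀ i, 0 < k i) ∧ (∀ i j, i ≠ j → (e i + 1) * k j ≠ (e j + 1) * k i) ∧
          N.domain = {x | ∀ i, x i ∈ Set.Ioo (0:ℝ) 1} ∧
          EqOn N.integrand (fun x => (c : ℝ) * (∏ l, x l ^ (e l)) / (1 - ∏ l, x l ^ (k l))) N.domain ∧
          y = of N} ∪
       {y : FormalRep | ∃ (m : ℕ) (N : IntegralRep m), m ≤ 1 ∧ N.IsRational ∧ y = of N})) :
    ∃ x' ∈ AddSubgroup.closure
        {y : FormalRep | ∃ (m : ℕ) (N : IntegralRep m), m ≤ 1 ∧ N.IsRational ∧ y = of N},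
      x - x' ∈ relations := by
  induction hx using AddSubgroup.closure_induction with
  | mem y hy =>
    rcases hy with hy | hy
    · obtain ⟨n, k, e, c, N, hk, hres, hNd, hNi, rfl⟩ := hy
      exact offresN_exists_mem_dimLeOneClosure n k e hk hres c N hNd hNi
    · exact ⟨y, AddSubgroup.subset_closure hy, by simp [relations.zero_mem]⟩
  | zero => exact ⟨0, AddSubgroup.zero_mem _, by simp [relations.zero_mem]⟩
  | add y z _ _ ihy ihz =>
    obtain ⟨y', hy', ey⟩ := ihy
    obtain ⟨z', hz', ez⟩ := ihz
    refine ⟨y' + z', AddSubgroup.add_mem _ hy' hz', ?_⟩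
    have e : y + z - (y' + z') = (y - y') + (z - z') := by abel
    rw [e]
    exact relations.add_mem ey ez
  | neg y _ ihy =>
    obtain ⟨y', hy', ey⟩ := ihy
    refine ⟨-y', AddSubgroup.neg_mem _ hy', ?_⟩
    have e : -y - -y' = -(y - y') := by abel
    rw [e]
    exact relations.neg_mem ey

/-- **Conjecture 1 of Kontsevich–Zagier, kernel form, for the TOTALLY-OFF-RESONANCE BOX LAYER OF ALL
WEIGHTS AND ALL LEVELS** — unconditionally: a formal `ℤ`-combination of boxes
`[(0,1)^w, c (Π xₗ^{eₗ})/(1 − Π xₗ^{kₗ})]` (`w ≥ 2`, `c ∈ ℚ`, `kₗ ≥ 1`, resonance parameters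
`θₗ = (eₗ+1)/kₗ` pairwise distinct) and of rational representations of dimension `≤ 1`, with value `0`,
is a relation (power substitution, sorting, merge, and `w − 2` rounds of re-banding + Newton–Leibniz +
splitting down to the level-`K` triangle, then dimension one and Baker — seat c4's
`Dlog.mem_relations_of_eval_eq_zero_of_dim_le_one`). [cite: KontsevichZagier2001, §1.2 Conjecture 1] -/
theorem offresN_mem_relations_of_eval_eq_zero_of_mem_closure {x : FormalRep}
    (hx : x ∈ AddSubgroup.closure
      ({y : FormalRep | ∃ (n : ℕ) (k e : Fin (n + 2) → ℕ) (c : ℚ) (N : IntegralRep (n + 2)),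
          (∀ i, 0 < k i) ∧ (∀ i j, i ≠ j → (e i + 1) * k j ≠ (e j + 1) * k i) ∧
          N.domain = {x | ∀ i, x i ∈ Set.Ioo (0:ℝ) 1} ∧
          EqOn N.integrand (fun x => (c : ℝ) * (∏ l, x l ^ (e l)) / (1 - ∏ l, x l ^ (k l))) N.domain ∧
          y = of N} ∪
       {y : FormalRep | ∃ (m : ℕ) (N : IntegralRep m), m ≤ 1 ∧ N.IsRational ∧ y = of N}))
    (hv : eval x = 0) : x ∈ relations := by
  obtain ⟨x', hx', e⟩ := exists_mem_dimLeOneClosure_of_mem_offresNClosure hx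
  have h0 : eval x' = 0 := by
    have h := relations_le_ker_eval_holds e
    rw [AddMonoidHom.mem_ker, map_sub, hv, zero_sub, neg_eq_zero] at h
    exact h
  have hx'r := mem_relations_of_eval_eq_zero_of_dim_le_one hx' h0
  have e' : x = (x - x') + x' := by abel
  rw [e']
  exact relations.add_mem e hx'r

/-- **A totally-off-resonance box of any weight `≥ 2` and any level against ANY rational representation
of dimension `≤ 1`** — equal values imply KZ-equivalence, unconditionally (e.g. a quadruple integral
`∫_{(0,1)⁴} x₁x₂²x₃³/(1 − x₀x₁x₂x₃) = Σ_n 1/((n+1)(n+2)(n+3)(n+4)) = 1/18` against the rational point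
`[pt, 1/18]`). [cite: KontsevichZagier2001, §1.2 Conjecture 1] -/
theorem offresN_equivalent_dimLeOne_of_value_eq {m : ℕ} (hm : m ≤ 1) (n : ℕ) (k e : Fin (n + 2) → ℕ)
    (hk : ∀ i, 0 < k i) (hres : ∀ i j, i ≠ j → (e i + 1) * k j ≠ (e j + 1) * k i) (c : ℚ)
    (N : IntegralRep (n + 2)) (M : IntegralRep m) (hM : M.IsRational)
    (hNd : N.domain = {x | ∀ i, x i ∈ Set.Ioo (0:ℝ) 1})
    (hNi : EqOn N.integrand (fun x => (c : ℝ) * (∏ l, x l ^ (e l)) / (1 - ∏ l, x l ^ (k l))) N.domain)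
    (hv : N.value = M.value) : Equivalent N M := by
  refine offresN_mem_relations_of_eval_eq_zero_of_mem_closure (AddSubgroup.sub_mem _
    (AddSubgroup.subset_closure (Or.inl ⟨n, k, e, c, N, hk, hres, hNd, hNi, rfl⟩))
    (AddSubgroup.subset_closure (Or.inr ⟨m, M, hm, hM, rfl⟩))) ?_
  rw [map_sub, eval_of, eval_of, hv, sub_self]

/-- **Two totally-off-resonance boxes (any weights `≥ 2`, any levels) with equal values are
KZ-equivalent** (unconditionally). [cite: KontsevichZagier2001, §1.2 Conjecture 1] -/
theorem offresN_equivalent_of_value_eq (n n' : ℕ) (k e : Fin (n + 2) → ℕ) (k' e' : Fin (n' + 2) → ℕ)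
    (hk : ∀ i, 0 < k i) (hres : ∀ i j, i ≠ j → (e i + 1) * k j ≠ (e j + 1) * k i)
    (hk' : ∀ i, 0 < k' i) (hres' : ∀ i j, i ≠ j → (e' i + 1) * k' j ≠ (e' j + 1) * k' i) (c c' : ℚ)
    (N : IntegralRep (n + 2)) (N' : IntegralRep (n' + 2))
    (hNd : N.domain = {x | ∀ i, x i ∈ Set.Ioo (0:ℝ) 1})
    (hNi : EqOn N.integrand (fun x => (c : ℝ) * (∏ l, x l ^ (e l)) / (1 - ∏ l, x l ^ (k l))) N.domain)
    (hN'd : N'.domain = {x | ∀ i, x i ∈ Set.Ioo (0:ℝ) 1})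
    (hN'i : EqOn N'.integrand (fun x => (c' : ℝ) * (∏ l, x l ^ (e' l)) / (1 - ∏ l, x l ^ (k' l)))
      N'.domain)
    (hv : N.value = N'.value) : Equivalent N N' := by
  refine offresN_mem_relations_of_eval_eq_zero_of_mem_closure (AddSubgroup.sub_mem _
    (AddSubgroup.subset_closure (Or.inl ⟨n, k, e, c, N, hk, hres, hNd, hNi, rfl⟩))
    (AddSubgroup.subset_closure (Or.inl ⟨n', k', e', c', N', hk', hres', hN'd, hN'i, rfl⟩))) ?_
  rw [map_sub, eval_of, eval_of, hv, sub_self]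

end Summit.KontsevichZagierPeriods.HurwitzMicroSectors.NormalFormPrinciple.PiBox.WeightN
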